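import Mathlib.CategoryTheory.CofilteredSystem
import Mathlib.Topology.Algebra.Group.Quotient
import Literature.AnabelianGeometry.SemiGraphs.SubgroupPresentationCosetGraph
import Literature.AnabelianGeometry.SemiGraphs.TemperedBranchPairProfinite
import HarnessLib

/-!
# [SemiAnbd] Thm 3.7 (iii) p. 41 / §5 p. 65: the TOPOLOGICAL discharge of the algebraic tower hypotheses
# `hHK` / `hMK` / `hlift` / `hliftE` of the two-sided coset-graph dictionaries (T54-B, piece (P-K))

Mochizuki, *Semi-graphs of anabelioids*, Publ. RIMS **42** (2006), proof of Thm. 3.7 (iii) p. 41 with the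
author's Comments (6)(b) ("since the semi-graphs `𝔾_j` are all finite … converge in the profinite
topology"), §5 p. 65 [cite: MochizukiSemiAnbd2006, Thm 3.7(iii) p.41].

PROOF-ONLY, pure topological group theory (cell row T54-B, producer debt `HOME/plan/GAP-LEDGER.md`
G-w4d053-1; piece (P-K) of the (AI4″) producer, holder abc-iut-w4-d059, this file by the second seat
abc-iut-w4-d085).  abc-iut-w4-d059's `SubgroupPresentationStabilizers.lean` proves the two-sided vertex /
edge dictionaries (I1)–(I3) for the deck action on a coset-graph tower `P.cosetGraph (K j)` under two
ALGEBRAIC tower hypotheses, stated there as binders: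
`hHK : ∀ w x, (∀ j, x ∈ H_w · K_j) → x ∈ H_w` (resp. `hMK` for the edge groups `M_e`) and
`hlift : ∀ w (y : J → Γ), (double cosets H_w y_j K_i compatible) → ∃ z, ∀ j, H_w z K_j = H_w y_j K_j`
(resp. `hliftE` over a final segment `{j // j₁ ≤ j}`).  This file DISCHARGES them from topology:

* `hHK_of_isCompact` / `hMK_of_isCompact` — from `H_w` (resp. `M_e`) COMPACT, the `K_j` open, directed
  (antitone along the directed `J`) with trivial intersection, in a Hausdorff group: abc-iut-L3-t11's
  `iInter_mul_coe_eq_of_isCompact` (`⋂_j H · K_j = H`) verbatim;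
* `exists_doubleCoset_lift_of_complete` — the generic LIFT: for `H` compact, `K_j` open normal antitone and
  `Γ` COMPLETE for the `K_j` (binder `hcomplete`: every left-coset-compatible family `(z_j K_j)_j` has a
  limit `g`, `g⁻¹ z_j ∈ K_j`), every compatible system of double cosets `(H y_j K_j)_j` comes from ONE
  `z` — Kőnig (`nonempty_sections_of_finite_inverse_system`) on the inverse system of the FINITE nonempty
  sets `{h y_j K_j : h ∈ H} ⊆ Γ ⧸ K_j` (finite: image of the compact `H y_j` in the discrete `Γ ⧸ K_j`),
  then `hcomplete`;
* `complete_subtype_ge` — completeness descends to final segments `{j // j₁ ≤ j}`;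
* `hlift_of_complete` / `hliftE_of_complete` — abc-iut-w4-d059's binders `hlift` / `hliftE` VERBATIM.

Nothing here refers to the IUT corpus; no side is taken on [IUTchIII] Cor 3.12; typed ≠ proved.
-/

namespace Literature.AnabelianGeometry.SemiGraphs

open CategoryTheory Opposite Topology
open scoped Pointwise

universe v u

/-! ### Generic: compact subgroups against open normal antitone families -/

section Generic

variable {G : Type u} [Group G] [TopologicalSpace G] [IsTopologicalGroup G]
variable {J : Type v} [Preorder J]

/-- `⋂_j S · K_j = S` for a compact `S` (membership form): if `x ∈ S · K_j` for every `j` of a nonempty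
directed family of open subgroups with trivial intersection (antitone along a directed order), then
`x ∈ S` — abc-iut-L3-t11's `iInter_mul_coe_eq_of_isCompact`. [cite: MochizukiSemiAnbd2006, Thm 3.7(iii) p.41] -/
theorem mem_of_forall_mem_mul_of_isCompact [T2Space G] [IsDirectedOrder J] [Nonempty J]
    (K : J → Subgroup G) (hK : ∀ ⦃i j : J⦄, i ≤ j → K j ≤ K i) (hKo : ∀ j, IsOpen (K j : Set G))
    (hKbot : ∀ g : G, (∀ j, g ∈ K j) → g = 1) {S : Set G} (hS : IsCompact S) {x : G}
    (hx : ∀ j, x ∈ S * (K j : Set G)) : x ∈ S := by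
  have hdir : ∀ i j : J, ∃ k, K k ≤ K i ∧ K k ≤ K j := fun i j => by
    obtain ⟨k, hik, hjk⟩ := exists_ge_ge i j
    exact ⟨k, hK hik, hK hjk⟩
  rw [← iInter_mul_coe_eq_of_isCompact K hKo hdir hKbot hS, Set.mem_iInter]
  exact hx

/-- The image of the compact `S · y` in the discrete coset space `G ⧸ K` of an OPEN subgroup is finite
("since the semi-graphs `𝔾_j` are all finite"). [cite: MochizukiSemiAnbd2006, Thm 3.7(iii) p.41] -/
theorem finite_image_mk_mul_of_isCompact (K : Subgroup G) (hKo : IsOpen (K : Set G)) {S : Set G}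
    (hS : IsCompact S) (y : G) :
    ((fun h : G => (QuotientGroup.mk (h * y) : G ⧸ K)) '' S).Finite := by
  haveI : DiscreteTopology (G ⧸ K) := QuotientGroup.discreteTopology hKo
  exact (hS.image ((QuotientGroup.continuous_mk (N := K)).comp
    (continuous_id.mul continuous_const))).finite_of_discrete

/-- **The LIFT of compatible double cosets** (Comments (6)(b): "converge in the profinite topology"): for
`S` compact, `K_j` open normal antitone over a directed `J`, and `G` COMPLETE for the `K_j` (`hcomplete`),
every system `(y_j)_j` whose double cosets `S y_j K_i` are compatible comes from ONE `z`:
`S z K_j = S y_j K_j` for all `j` — Kőnig on the finite nonempty sets `{h y_j K_j : h ∈ S}`, then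
completeness. [cite: MochizukiSemiAnbd2006, Thm 3.7(iii) p.41] -/
theorem exists_doubleCoset_lift_of_complete [IsDirectedOrder J]
    (K : J → Subgroup G) [∀ j, (K j).Normal] (hK : ∀ ⦃i j : J⦄, i ≤ j → K j ≤ K i)
    (hKo : ∀ j, IsOpen (K j : Set G))
    (hcomplete : ∀ z : J → G, (∀ ⦃i j : J⦄, i ≤ j → (z i)⁻¹ * z j ∈ K i) →
      ∃ g : G, ∀ j, g⁻¹ * z j ∈ K j)
    (S : Subgroup G) (hS : IsCompact (S : Set G)) (y : J → G)
    (hy : ∀ ⦃i j : J⦄, i ≤ j → DoubleCoset.mk S (K i) (y j) = DoubleCoset.mk S (K i) (y i)) :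
    ∃ z : G, ∀ j, DoubleCoset.mk S (K j) z = DoubleCoset.mk S (K j) (y j) := by
  classical
  -- the finite nonempty fibres `F j = {h y_j K_j : h ∈ S} ⊆ G ⧸ K_j`
  let F : ∀ j : J, Set (G ⧸ K j) := fun j =>
    (fun h : G => (QuotientGroup.mk (h * y j) : G ⧸ K j)) '' (S : Set G)
  have hFfin : ∀ j, (F j).Finite := fun j => finite_image_mk_mul_of_isCompact (K j) (hKo j) hS (y j)
  have hFne : ∀ j, (F j).Nonempty := fun j => ⟨_, 1, S.one_mem, rfl⟩
  -- the transition maps `G ⧸ K_j → G ⧸ K_i` carry `F j` into `F i` (compatibility of the double cosets)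
  have hmaps : ∀ ⦃i j : J⦄ (h : i ≤ j), Set.MapsTo (Subgroup.quotientMapOfLE (hK h)) (F j) (F i) := by
    rintro i j h _ ⟨s, hs, rfl⟩
    obtain ⟨h', hh', k, hk, hyi⟩ := (DoubleCoset.eq S (K i) (y j) (y i)).mp (hy h)
    -- `y i = h' * y j * k`, so `s y_j = (s h'⁻¹) y_i k⁻¹` and `k⁻¹ ∈ K i`
    refine ⟨s * h'⁻¹, S.mul_mem hs (S.inv_mem hh'), ?_⟩
    rw [Subgroup.quotientMapOfLE_apply_mk, QuotientGroup.eq]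
    have : (s * h'⁻¹ * y i)⁻¹ * (s * y j) = k⁻¹ := by rw [hyi]; group
    rw [this]
    exact (K i).inv_mem hk
  -- the inverse system of finite nonempty sets, as a functor `Jᵒᵖ ⥤ Type u`
  let Fn : Jᵒᵖ ⥤ Type u :=
    { obj := fun X => F X.unop
      map := fun {X Y} f => TypeCat.ofHom ((hmaps f.unop.le).restrict _ _ _)
      map_id := fun X => by
        refine ConcreteCategory.hom_ext _ _ fun x => ?_
        obtain ⟨q, hq⟩ := x
        apply Subtype.ext
        simp only [TypeCat.ofHom_apply, Set.MapsTo.val_restrict_apply, types_id_apply]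
        induction q using QuotientGroup.induction_on with
        | H a => rfl
      map_comp := fun {X Y Z} f g => by
        refine ConcreteCategory.hom_ext _ _ fun x => ?_
        obtain ⟨q, hq⟩ := x
        apply Subtype.ext
        simp only [TypeCat.ofHom_apply, Set.MapsTo.val_restrict_apply, types_comp_apply]
        induction q using QuotientGroup.induction_on with
        | H a => rfl }
  have hmap : ∀ {X Y : Jᵒᵖ} (f : X ⟶ Y) (x : Fn.obj X),
      (Fn.map f x).1 = Subgroup.quotientMapOfLE (hK f.unop.le) x.1 := fun f x => rfl
  haveI : ∀ X : Jᵒᵖ, Finite (Fn.obj X) := fun X => (hFfin X.unop).to_subtype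
  haveI : ∀ X : Jᵒᵖ, Nonempty (Fn.obj X) := fun X => (hFne X.unop).to_subtype
  obtain ⟨sec, hsec⟩ := nonempty_sections_of_finite_inverse_system Fn
  -- representatives `z j = h_j * y j` of the chosen compatible cosets
  have hrep : ∀ j, ∃ h ∈ S, (sec (op j)).1 = (QuotientGroup.mk (h * y j) : G ⧸ K j) := fun j => by
    obtain ⟨h, hh, hq⟩ := (sec (op j)).2
    exact ⟨h, hh, hq.symm⟩
  choose h hhS hhq using hrep
  -- compatibility of the representatives modulo the `K i`
  have hz : ∀ ⦃i j : J⦄, i ≤ j → (h i * y i)⁻¹ * (h j * y j) ∈ K i := by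
    intro i j hij
    -- `quotientMapOfLE (sec j) = sec i`
    have hval : Subgroup.quotientMapOfLE (hK hij) (sec (op j)).1 = (sec (op i)).1 := by
      rw [← hmap ((homOfLE hij).op : op j ⟶ op i) (sec (op j)), hsec]
    rw [hhq j, hhq i, Subgroup.quotientMapOfLE_apply_mk, QuotientGroup.eq] at hval
    -- `hval : (h j * y j)⁻¹ * (h i * y i) ∈ K i`
    simpa using (K i).inv_mem hval
  obtain ⟨g, hg⟩ := hcomplete (fun j => h j * y j) hz
  refine ⟨g, fun j => ?_⟩
  -- `S g K_j = S (h_j y_j) K_j = S y_j K_j`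
  rw [DoubleCoset.eq]
  exact ⟨(h j)⁻¹, S.inv_mem (hhS j), g⁻¹ * (h j * y j), hg j, by group⟩

omit [TopologicalSpace G] [IsTopologicalGroup G] in
/-- **Completeness descends to final segments**: if every `K`-compatible family over `J` has a limit, so
does every `K`-compatible family over `{j // j₁ ≤ j}` (extend along directed choices).
[cite: MochizukiSemiAnbd2006, Thm 3.7(iii) p.41] -/
theorem complete_subtype_ge [IsDirectedOrder J]
    (K : J → Subgroup G) (hK : ∀ ⦃i j : J⦄, i ≤ j → K j ≤ K i)
    (hcomplete : ∀ z : J → G, (∀ ⦃i j : J⦄, i ≤ j → (z i)⁻¹ * z j ∈ K i) →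
      ∃ g : G, ∀ j, g⁻¹ * z j ∈ K j)
    (j₁ : J) (z : {j : J // j₁ ≤ j} → G)
    (hz : ∀ ⦃i j : {j : J // j₁ ≤ j}⦄, i.1 ≤ j.1 → (z i)⁻¹ * z j ∈ K i.1) :
    ∃ g : G, ∀ j, g⁻¹ * z j ∈ K j.1 := by
  classical
  -- directed choice of an index `k j ≥ j, j₁`
  have hch : ∀ j : J, ∃ k : J, j ≤ k ∧ j₁ ≤ k := fun j => exists_ge_ge j j₁
  choose k hjk hj₁k using hch
  -- the extended family
  let z' : J → G := fun j => z ⟨k j, hj₁k j⟩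
  have hz' : ∀ ⦃i j : J⦄, i ≤ j → (z' i)⁻¹ * z' j ∈ K i := by
    intro i j hij
    obtain ⟨m, him, hjm⟩ := exists_ge_ge (k i) (k j)
    have h1 : (z ⟨k i, hj₁k i⟩)⁻¹ * z ⟨m, (hj₁k i).trans him⟩ ∈ K (k i) :=
      hz (i := ⟨k i, hj₁k i⟩) (j := ⟨m, (hj₁k i).trans him⟩) him
    have h2 : (z ⟨k j, hj₁k j⟩)⁻¹ * z ⟨m, (hj₁k i).trans him⟩ ∈ K (k j) :=
      hz (i := ⟨k j, hj₁k j⟩) (j := ⟨m, (hj₁k i).trans him⟩) hjm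
    have h1' : (z ⟨k i, hj₁k i⟩)⁻¹ * z ⟨m, (hj₁k i).trans him⟩ ∈ K i := hK (hjk i) h1
    have h2' : (z ⟨m, (hj₁k i).trans him⟩)⁻¹ * z ⟨k j, hj₁k j⟩ ∈ K i := by
      have := (K (k j)).inv_mem h2
      rw [mul_inv_rev, inv_inv] at this
      exact hK (hij.trans (hjk j)) this
    have := (K i).mul_mem h1' h2'
    simpa [z', mul_assoc] using this
  obtain ⟨g, hg⟩ := hcomplete z' hz'
  refine ⟨g, fun j => ?_⟩
  -- `g⁻¹ z_j = (g⁻¹ z'_{j}) (z'_{j}⁻¹ z_j)` with `j ≤ k j` inside the final segment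
  have h3 : (z j)⁻¹ * z ⟨k j.1, hj₁k j.1⟩ ∈ K j.1 := hz (i := j) (j := ⟨k j.1, hj₁k j.1⟩) (hjk j.1)
  have h3' : (z ⟨k j.1, hj₁k j.1⟩)⁻¹ * z j ∈ K j.1 := by
    have := (K j.1).inv_mem h3
    rwa [mul_inv_rev, inv_inv] at this
  have := (K j.1).mul_mem (hg j.1) h3'
  simpa [z', mul_assoc] using this

end Generic

/-! ### The discharge of abc-iut-w4-d059's binders `hHK` / `hMK` / `hlift` / `hliftE` -/

namespace SemiGraph

namespace SubgroupPresentation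

variable {𝔾 : SemiGraph.{u}} {Γ : Type u} [Group Γ] [TopologicalSpace Γ] [IsTopologicalGroup Γ]
  (P : SubgroupPresentation 𝔾 Γ)
variable {J : Type v} [Preorder J] [IsDirectedOrder J] (K : J → Subgroup Γ)
  (hK : ∀ ⦃i j : J⦄, i ≤ j → K j ≤ K i) (hKo : ∀ j, IsOpen (K j : Set Γ))

include hK hKo

/-- **`hHK` from topology**: if the vertex groups `H_w` are compact and the `K_j` are open, directed with
trivial intersection (Hausdorff `Γ`), then `⋂_j H_w · K_j = H_w` — abc-iut-w4-d059's binder `hHK` verbatim.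
[cite: MochizukiSemiAnbd2006, Thm 3.7(iii) p.41] -/
theorem hHK_of_isCompact [T2Space Γ] [Nonempty J] (hKbot : ∀ g : Γ, (∀ j, g ∈ K j) → g = 1)
    (hHc : ∀ w : 𝔾.Vertex, IsCompact (P.H w : Set Γ)) :
    ∀ (w : 𝔾.Vertex) (x : Γ), (∀ j, x ∈ (P.H w : Set Γ) * (K j : Set Γ)) → x ∈ P.H w :=
  fun w _ hx => mem_of_forall_mem_mul_of_isCompact K hK hKo hKbot (hHc w) hx

/-- **`hMK` from topology**: the same for the edge groups `M_e` — abc-iut-w4-d059's binder `hMK` verbatim.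
[cite: MochizukiSemiAnbd2006, Thm 3.7(iii) p.41] -/
theorem hMK_of_isCompact [T2Space Γ] [Nonempty J] (hKbot : ∀ g : Γ, (∀ j, g ∈ K j) → g = 1)
    (hMc : ∀ e : 𝔾.Edge, IsCompact (P.M e : Set Γ)) :
    ∀ (e : 𝔾.Edge) (x : Γ), (∀ j, x ∈ (P.M e : Set Γ) * (K j : Set Γ)) → x ∈ P.M e :=
  fun e _ hx => mem_of_forall_mem_mul_of_isCompact K hK hKo hKbot (hMc e) hx

/-- **`hlift` from topology**: if the vertex groups `H_w` are compact, the `K_j` open normal antitone, and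
`Γ` is complete for the `K_j` (`hcomplete`), every compatible system of double cosets `(H_w y_j K_j)_j`
comes from ONE representative — abc-iut-w4-d059's binder `hlift` verbatim.
[cite: MochizukiSemiAnbd2006, Thm 3.7(iii) p.41] -/
theorem hlift_of_complete [∀ j, (K j).Normal]
    (hcomplete : ∀ z : J → Γ, (∀ ⦃i j : J⦄, i ≤ j → (z i)⁻¹ * z j ∈ K i) →
      ∃ g : Γ, ∀ j, g⁻¹ * z j ∈ K j)
    (hHc : ∀ w : 𝔾.Vertex, IsCompact (P.H w : Set Γ)) :
    ∀ (w : 𝔾.Vertex) (y : J → Γ),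
      (∀ ⦃i j : J⦄, i ≤ j → DoubleCoset.mk (P.H w) (K i) (y j) = DoubleCoset.mk (P.H w) (K i) (y i)) →
      ∃ z : Γ, ∀ j, DoubleCoset.mk (P.H w) (K j) z = DoubleCoset.mk (P.H w) (K j) (y j) :=
  fun w y hy => exists_doubleCoset_lift_of_complete K hK hKo hcomplete (P.H w) (hHc w) y hy

/-- **`hliftE` from topology**: the same for the edge groups `M_e` over a final segment `{j // j₁ ≤ j}`
(completeness descends by `complete_subtype_ge`) — abc-iut-w4-d059's binder `hliftE` verbatim.
[cite: MochizukiSemiAnbd2006, Thm 3.7(iii) p.41] -/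
theorem hliftE_of_complete [∀ j, (K j).Normal]
    (hcomplete : ∀ z : J → Γ, (∀ ⦃i j : J⦄, i ≤ j → (z i)⁻¹ * z j ∈ K i) →
      ∃ g : Γ, ∀ j, g⁻¹ * z j ∈ K j)
    (hMc : ∀ e : 𝔾.Edge, IsCompact (P.M e : Set Γ)) (j₁ : J) :
    ∀ (e : 𝔾.Edge) (y : {j : J // j₁ ≤ j} → Γ),
      (∀ ⦃i j : {j : J // j₁ ≤ j}⦄, i.1 ≤ j.1 →
        DoubleCoset.mk (P.M e) (K i.1) (y j) = DoubleCoset.mk (P.M e) (K i.1) (y i)) →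
      ∃ z : Γ, ∀ j, DoubleCoset.mk (P.M e) (K j.1) z = DoubleCoset.mk (P.M e) (K j.1) (y j) := by
  intro e y hy
  haveI : IsDirectedOrder {j : J // j₁ ≤ j} := by
    refine ⟨fun a b => ?_⟩
    obtain ⟨c, hac, hbc⟩ := exists_ge_ge a.1 b.1
    exact ⟨⟨c, a.2.trans hac⟩, hac, hbc⟩
  exact exists_doubleCoset_lift_of_complete (J := {j : J // j₁ ≤ j}) (fun j => K j.1)
    (fun i j h => hK h) (fun j => hKo j.1) (complete_subtype_ge K hK hcomplete j₁) (P.M e) (hMc e) y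
    (fun i j h => hy h)

end SubgroupPresentation

end SemiGraph

end Literature.AnabelianGeometry.SemiGraphs
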